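import Summits.QuantumFields.YangMills.Theorems.BalabanUVNodesN06CutLettersPinsPrintAtRecord
import Literature.MathematicalPhysics.QuantumFieldTheory.Balaban1983to89.B9RWSums347DefiniteFaces
import Literature.MathematicalPhysics.QuantumFieldTheory.Balaban1983to89.B9Thm313WholeRgdFrom3152
import Literature.MathematicalPhysics.QuantumFieldTheory.Balaban1983to89.B9RowSum261DefiniteFaces
import Literature.MathematicalPhysics.QuantumFieldTheory.Balaban1983to89.B9PerturbationMajorantsAtLettersPhys
import Literature.MathematicalPhysics.QuantumFieldTheory.Balaban1983to89.B9GradViaDivLettersTransported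
import Literature.MathematicalPhysics.QuantumFieldTheory.Balaban1983to89.B9BackgroundsKLevelV1R
import Literature.MathematicalPhysics.QuantumFieldTheory.Balaban1983to89.B9GeoLemma21KLevelV1
import Literature.MathematicalPhysics.QuantumFieldTheory.Balaban1983to89.B9PinMembersKLevelV1
import Literature.MathematicalPhysics.QuantumFieldTheory.Balaban1983to89.B9LettersHZAtOne
import Literature.MathematicalPhysics.QuantumFieldTheory.Balaban1983to89.B9CoReadingCoordsHolderAdm

/-!
# BalabanUVNodes ∕ N06 ([B9], `Dag.B9_main`) — CASCADE-K PIECE K2 (director-ym №383): ROWS 20–21's LETTER `rgd2` (R∇\*_UG₁ : 𝔠⁽⁰⁾ → 𝔠_W⁽¹⁾) OF `…N06Rgd2LegAtPinsPhysPU`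
# RE-PRESSED ONCE OVER A SITE-TRANSPORTER PARAMETER `parS` (the pins `parS x = parSymY`, `Gp x = GpY parSymY` REMOVED; no transporter law is used by the sup-norm engine)

Track A of `YM-PLAN.md` (cell `pub-ymgap`, HUMAN RULING D-0062), node **N06** = [Balaban1985BackgroundPropagators] Thms 3.1–3.15; rows 20–21, seat
`pub-ymgap-dag-n06-l` (g36).  A HELPER for dag-n06-d's knit certificate skeleton «K» (K3).
WHY.  `hrgd2_of_pinsP_geo9Y` (✓, this lineage g29, over g16's `B9Thm313WholeRgdFrom3152.rgd2_of_ids3152`) already carries a transporter PARAMETER `parS` and a `G′`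
parameter `Gp`, but PINS them (`hparS : parS x = parSymY x.toKIdx`, `hGp : Gp x = GpY … parSymY`) and states `hRco12` and the (3.152) antecedent at `parSymY`.  dag-n06-d's
⚑ LOCATED-K census lists it among the 46 parSymY-pinned rows the knit certificate cannot consume.  This file is the parametric re-press: the two pins are DROPPED, `Gp x`
is keyed `GpY x.toKIdx (parS x)` (`hGp`), `hRco12` reads `RcoK … (parS x) (GpPhysY … (parS x))`, and the member-wise (3.152) antecedent is at `GcoS … (GpY … (parS x))`;
the sup-norm engine `rgd2_of_ids3152`, `rcoK_GpPhysY ∕ rcoK_eq`, the member facts and the budget are called VERBATIM — NO transporter law is needed (the sup road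
uses no transposition).  Instances: `parS := parSymY` recovers the landed theorem; `parS := parKnitY` is the knit certificate's row.
★★ `hrgd2_of_pinsP_geo9Y_par`.  HONEST FRAMING.  Mechanical re-press; `h31 h49 hRco12` and the member-wise `Ids3152 …` stay HYPOTHESES; nothing of [B9] asserted;
COUNT-NEUTRAL; N06 NOT discharged; K1⁹ NOT closed; one finite 𝕋⁴ programme at fixed `ε` — NOT continuum ∕ OS ∕ mass gap ∕ Clay.  0 `def`, 0 `sorry`.
[cite: Balaban1985BackgroundPropagators, (3.152)–(3.153) p.426, Thm 3.1 (3.42) p.397, (3.49) p.399, Thm 3.13 p.426, (3.19) p.393, (3.35)–(3.36) p.396;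
Balaban1985Averaging, Prop. 2 p.26; Balaban1984PropagatorsII, (2.52)–(2.56) pp.232–233, Lemma 2.1 (2.60)–(2.61) p.234]
-/

noncomputable section

namespace Summit.QuantumFields.YangMills.BalabanUVNodes.N06Rgd2LegAtPinsPhysPUPar

open Literature.MathematicalPhysics.QuantumFieldTheory.Balaban1983to89
open Literature.MathematicalPhysics.QuantumFieldTheory.Balaban1983to89.Node00 (FBondY IBondY SiteY CfgY SiteParY SiteOpY BondParY parBY GpY GpPhysY)
open Literature.MathematicalPhysics.QuantumFieldTheory.Balaban1983to89.Node00.OpsYSectDCoords (DvcoKH DvscoKH RcoK cR39_trBasis_pos)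
open Literature.MathematicalPhysics.QuantumFieldTheory.Balaban1983to89.B9Thm39ReadingCoords (cR39)
open Literature.MathematicalPhysics.QuantumFieldTheory.Balaban1983to89.B9Thm34Ext (toB6)
open Literature.MathematicalPhysics.QuantumFieldTheory.Balaban1983to89.B11SectG (HasMaj BlockNorm RowSum)
open Literature.MathematicalPhysics.QuantumFieldTheory.Balaban1983to89.B9Thm312Whole (cNorm GeoOK)
open Literature.MathematicalPhysics.QuantumFieldTheory.Balaban1983to89.B9Thm312WholeClasses (cNormR)
open Literature.MathematicalPhysics.QuantumFieldTheory.Balaban1983to89.B9RWSums343Holder (HolderProbes)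
open Literature.MathematicalPhysics.QuantumFieldTheory.Balaban1983to89.B9RWSums343to347Whole (Facts347)
open Literature.MathematicalPhysics.QuantumFieldTheory.Balaban1983to89.B9CoReadingCoords (XBK blkBK)
open Literature.MathematicalPhysics.QuantumFieldTheory.Balaban1983to89.B9CoReadingCoordsS (XSK sIK blkSK GcoS)
open Literature.MathematicalPhysics.QuantumFieldTheory.Balaban1983to89.B9CoReadingCoordsH (XHK)
open Literature.MathematicalPhysics.QuantumFieldTheory.Balaban1983to89.B9CoReadingCoordsHolder (PK)
open Literature.MathematicalPhysics.QuantumFieldTheory.Balaban1983to89.B9CoReadingCoordsTranspose (TrIdx trBasis)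
open Literature.MathematicalPhysics.QuantumFieldTheory.Balaban1983to89.B9PinMembersKLevelV1 (MemberY geo9Y)
open Literature.MathematicalPhysics.QuantumFieldTheory.Balaban1983to89.B9BackgroundsKLevelV1R (RegFamY bg9YR MemOfFam)
open Literature.MathematicalPhysics.QuantumFieldTheory.Balaban1983to89.B9GeoLemma21KLevelV1 (geo9Y_len_pos geo9Y_dist_triangle geo9Y_dist_comm)
open Literature.MathematicalPhysics.QuantumFieldTheory.Balaban1983to89.B9GeoNormsKLevelV1 (geo9K geo9K_dist_nonneg)
open Literature.MathematicalPhysics.QuantumFieldTheory.Balaban1983to89.B7Prop2SpecialUnitary (specialUnitaryUnits)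
open Literature.MathematicalPhysics.QuantumFieldTheory.Balaban1983to89.B9PerturbationMajorantAlgebra (Proj349Maj)
open Literature.MathematicalPhysics.QuantumFieldTheory.Balaban1983to89.B9PerturbationMajorantsAtLetters (PcoK rcoK_eq)
open Literature.MathematicalPhysics.QuantumFieldTheory.Balaban1983to89.B9PerturbationMajorantsAtLettersPhys (rcoK_GpPhysY)
open Literature.MathematicalPhysics.QuantumFieldTheory.Balaban1983to89.B9MultiscaleSmoothPartitionYNear (rNear)
open Literature.MathematicalPhysics.QuantumFieldTheory.Balaban1983to89.B9SmoothHolderClassP (bHZKP bHZKPG)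
open Literature.MathematicalPhysics.QuantumFieldTheory.Balaban1983to89.B9GradViaDivLettersTransported (taxiB)
open Literature.MathematicalPhysics.QuantumFieldTheory.Balaban1983to89.B9Thm313WholeCutLettersAtPinsP (wGp_bHZKPG_of_pins)
open Literature.MathematicalPhysics.QuantumFieldTheory.Balaban1983to89.B9RWSums347DefiniteFaces (exp261 facts347_exp261_geo9Y geo9Y_scalars)
open Literature.MathematicalPhysics.QuantumFieldTheory.Balaban1983to89.B9RowSum261DefiniteFaces (rowConst261 rowConst261_nonneg rowConst261_spec_of_rowSum261)
open Literature.MathematicalPhysics.QuantumFieldTheory.Balaban1983to89.B9GeoLemma21KLevelV1 (rowSum261_geo9Y)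
open Literature.MathematicalPhysics.QuantumFieldTheory.Balaban1983to89.B9SectDSup (weightNorm)
open Literature.MathematicalPhysics.QuantumFieldTheory.Balaban1983to89.B6RandomWalkHom (HasMajorantHom)
open Literature.MathematicalPhysics.QuantumFieldTheory.Balaban1983to89.B9Thm313WholeLettersCut (Letters313Zc)
open Literature.MathematicalPhysics.QuantumFieldTheory.Balaban1983to89.B9PerturbationMajorantAlgebra (Thm31GpMaj constA)
open Literature.MathematicalPhysics.QuantumFieldTheory.Balaban1983to89.B9Thm313WholeRgdFrom3152 (Ids3152 rgd2_of_ids3152)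
open Literature.MathematicalPhysics.QuantumFieldTheory.Balaban1983to89.B9Thm312Whole (Identities)
open Literature.MathematicalPhysics.QuantumFieldTheory.Balaban1983to89.B9CoReadingCoordsHolder (blkPK probeK wK w₀K)
open Literature.MathematicalPhysics.QuantumFieldTheory.Balaban1983to89.B9CoReadingCoordsHolderAdm (wKA holderProbesKA)
open Literature.MathematicalPhysics.QuantumFieldTheory.Balaban1983to89.B9LettersHZAtOne (plateau_pos)
open B6GlobalChartV1 (PV blkV1) open B6Ineq2142KLevelV1 (β lvl) open B6Geom246MultiLevelTorus (geomT)
open scoped Matrix.Norms.L2Operator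

variable {N : ℕ} {d ℓ : ℕ} {hd : 1 ≤ d + 1} {hL : Odd (ℓ + 1) ∧ 1 < ℓ + 1} {b₀ b₁ : ℝ} {Mstar : ℕ}

/-- ★★ **`rgd2` OVER A TRANSPORTER PARAMETER `parS`** (module docstring): `hrgd2_of_pinsP_geo9Y` with the pins `parS x = parSymY`, `Gp x = GpY parSymY` removed —
`Gp x = GpY (parS x)`, `R` read at `(parS x, GpPhysY (parS x))`, the member-wise (3.152) at `GcoS … (GpY (parS x))`; threshold `M` above which the letter holds at `(B₃, δ₃)`
for every member. [cite: Balaban1985BackgroundPropagators, (3.152)–(3.153) p.426 + Thm 3.1 (3.42) p.397 + (3.49) p.399 + Thm 3.13 p.426, (3.19) p.393; Balaban1984PropagatorsII, (2.52)–(2.56) pp.232–233 + Lemma 2.1 (2.60)–(2.61) p.234] -/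
theorem hrgd2_of_pinsP_geo9Y_par [NeZero N] [∀ x : MemberY d ℓ hd hL b₀ b₁ Mstar, Fintype (geo9Y x).Site]
    {R₁ R₂ : RegFamY d ℓ hd hL b₀ b₁ Mstar (Matrix (Fin N) (Fin N) ℂ)} (H : MemberY d ℓ hd hL b₀ b₁ Mstar → Prop)
    (bI : ∀ x : MemberY d ℓ hd hL b₀ b₁ Mstar, FBondY x.toKIdx → IBondY x.toKIdx)
    (parS : ∀ x : MemberY d ℓ hd hL b₀ b₁ Mstar, SiteParY (Matrix (Fin N) (Fin N) ℂ) x.toKIdx) {Gp : ∀ x : MemberY d ℓ hd hL b₀ b₁ Mstar, SiteOpY (Matrix (Fin N) (Fin N) ℂ) x.toKIdx}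
    (c : ℝ) {M₀ a₀ : ℝ} {αW σW δFW : ℝ} (hαW0 : 0 < αW) (hαW1 : αW < 1) (hσW : 0 < σW) (hδFW : 0 < δFW)
    (𝔬12 : ∀ x : MemberY d ℓ hd hL b₀ b₁ Mstar, B9Thm312Whole.Ops (geo9Y x) (bg9YR (Matrix (Fin N) (Fin N) ℂ) (specialUnitaryUnits (Fin N)) R₁ R₂ x) (XBK (TrIdx N) x.toKIdx) (XBK (TrIdx N) x.toKIdx) (XHK (TrIdx N) x.toKIdx) (XSK (TrIdx N) x.toKIdx))
    (hblk12 : ∀ x : MemberY d ℓ hd hL b₀ b₁ Mstar, (𝔬12 x).blk = blkBK x.toKIdx (bI x))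
    (hblkW12 : ∀ x : MemberY d ℓ hd hL b₀ b₁ Mstar, (𝔬12 x).blkW = blkSK x.toKIdx (sIK x.toKIdx (bI x)))
    (hDvco12 : ∀ (x : MemberY d ℓ hd hL b₀ b₁ Mstar) (U : (bg9YR (Matrix (Fin N) (Fin N) ℂ) (specialUnitaryUnits (Fin N)) R₁ R₂ x).Cfg), (𝔬12 x).Dv U = DvcoKH x.toKIdx (trBasis N) (bg9YR (Matrix (Fin N) (Fin N) ℂ) (specialUnitaryUnits (Fin N)) R₁ R₂ x) (fun U => U) U)
    (hDvsco12 : ∀ (x : MemberY d ℓ hd hL b₀ b₁ Mstar) (U : (bg9YR (Matrix (Fin N) (Fin N) ℂ) (specialUnitaryUnits (Fin N)) R₁ R₂ x).Cfg), (𝔬12 x).Dvstar U = DvscoKH x.toKIdx (trBasis N) (bg9YR (Matrix (Fin N) (Fin N) ℂ) (specialUnitaryUnits (Fin N)) R₁ R₂ x) (fun U => U) U)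
    (hRco12 : ∀ (x : MemberY d ℓ hd hL b₀ b₁ Mstar) (U : (bg9YR (Matrix (Fin N) (Fin N) ℂ) (specialUnitaryUnits (Fin N)) R₁ R₂ x).Cfg), (𝔬12 x).R U = RcoK x.toKIdx (trBasis N) (bg9YR (Matrix (Fin N) (Fin N) ℂ) (specialUnitaryUnits (Fin N)) R₁ R₂ x) (fun U => U) (parS x) (GpPhysY x.toKIdx (parS x)) U)
    {B₃ δ₃ : ℝ}
    {B₀ δ₀ CP δP : ℝ} (hB₀ : 0 ≤ B₀) (hCP : 0 ≤ CP)
    (hδ₀ : δFW ≤ δ₀) (hδP : δFW ≤ δP) (hbud : 0 ≤ δFW - αW * δFW - 2 * σW)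
    (hB₃r : constA (cR39 (trBasis N))⁻¹ B₀ CP (rowConst261 (@geo9Y d ℓ hd hL b₀ b₁ Mstar) σW) (((ℓ + 1 : ℕ) : ℝ)) ≤ B₃) (hδ₃w : δ₃ ≤ δFW - αW * δFW - 2 * σW)
    (hGp : ∀ x : MemberY d ℓ hd hL b₀ b₁ Mstar, Gp x = GpY x.toKIdx (parS x))
    (h31 : ∀ x : MemberY d ℓ hd hL b₀ b₁ Mstar, M₀ ≤ (geo9Y x).M → ∀ α₀ : ℝ, 0 < α₀ → (geo9Y x).M * α₀ ≤ a₀ → ∀ U : (bg9YR (Matrix (Fin N) (Fin N) ℂ) (specialUnitaryUnits (Fin N)) R₁ R₂ x).Cfg, (bg9YR (Matrix (Fin N) (Fin N) ℂ) (specialUnitaryUnits (Fin N)) R₁ R₂ x).Reg335 c α₀ U →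
      Thm31GpMaj (g := geo9Y x) (blkSK x.toKIdx (sIK x.toKIdx (bI x))) (blkBK x.toKIdx (bI x))
        (GcoS x.toKIdx (trBasis N) (bg9YR (Matrix (Fin N) (Fin N) ℂ) (specialUnitaryUnits (Fin N)) R₁ R₂ x) (fun U => U) (Gp x) U)
        (DvcoKH x.toKIdx (trBasis N) (bg9YR (Matrix (Fin N) (Fin N) ℂ) (specialUnitaryUnits (Fin N)) R₁ R₂ x) (fun U => U) U) (DvscoKH x.toKIdx (trBasis N) (bg9YR (Matrix (Fin N) (Fin N) ℂ) (specialUnitaryUnits (Fin N)) R₁ R₂ x) (fun U => U) U) 1 (H x) B₀ δ₀)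
    (h49 : ∀ x : MemberY d ℓ hd hL b₀ b₁ Mstar, M₀ ≤ (geo9Y x).M → ∀ α₀ : ℝ, 0 < α₀ → (geo9Y x).M * α₀ ≤ a₀ → ∀ U : (bg9YR (Matrix (Fin N) (Fin N) ℂ) (specialUnitaryUnits (Fin N)) R₁ R₂ x).Cfg, (bg9YR (Matrix (Fin N) (Fin N) ℂ) (specialUnitaryUnits (Fin N)) R₁ R₂ x).Reg335 c α₀ U →
      Proj349Maj (g := geo9Y x) (blkSK x.toKIdx (sIK x.toKIdx (bI x))) (blkBK x.toKIdx (bI x))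
        (PcoK x.toKIdx (trBasis N) (bg9YR (Matrix (Fin N) (Fin N) ℂ) (specialUnitaryUnits (Fin N)) R₁ R₂ x) (fun U => U) (parS x) (Gp x) U)
        (DvcoKH x.toKIdx (trBasis N) (bg9YR (Matrix (Fin N) (Fin N) ℂ) (specialUnitaryUnits (Fin N)) R₁ R₂ x) (fun U => U) U) (DvscoKH x.toKIdx (trBasis N) (bg9YR (Matrix (Fin N) (Fin N) ℂ) (specialUnitaryUnits (Fin N)) R₁ R₂ x) (fun U => U) U) 1 (H x) CP δP) :
    ∃ M13 : ℝ, ∀ x : MemberY d ℓ hd hL b₀ b₁ Mstar, letI : Fintype (geo9K x.toKIdx).Site := (inferInstance : Fintype (geo9Y x).Site); M13 ≤ (geo9Y x).M → ∀ α₀ : ℝ, 0 < α₀ → (geo9Y x).M * α₀ ≤ a₀ → ∀ U : (bg9YR (Matrix (Fin N) (Fin N) ℂ) (specialUnitaryUnits (Fin N)) R₁ R₂ x).Cfg, (bg9YR (Matrix (Fin N) (Fin N) ℂ) (specialUnitaryUnits (Fin N)) R₁ R₂ x).Reg335 c α₀ U →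
      (bg9YR (Matrix (Fin N) (Fin N) ℂ) (specialUnitaryUnits (Fin N)) R₁ R₂ x).Reg336 c α₀ U → Ids3152 (𝔬12 x) (GcoS x.toKIdx (trBasis N) (bg9YR (Matrix (Fin N) (Fin N) ℂ) (specialUnitaryUnits (Fin N)) R₁ R₂ x) (fun U => U) (GpY x.toKIdx (parS x))) U →
        HasMaj (cNorm 1 (H x) (𝔬12 x).blk (fun y => (geo9Y_len_pos x y).le) 0) (cNorm 1 (H x) (𝔬12 x).blkW (fun y => (geo9Y_len_pos x y).le) 1)
          ((𝔬12 x).R U ∘ₗ (𝔬12 x).Dvstar U ∘ₗ (𝔬12 x).G1 U ∘ₗ LinearMap.id) (fun a b => B₃ * Real.exp (-(δ₃ * (geo9Y x).dist a b))) := by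
  obtain ⟨Mg, hFa⟩ := facts347_exp261_geo9Y (d := d) (ℓ := ℓ) (hd := hd) (hL := hL) (b₀ := b₀) (b₁ := b₁) (Mstar := Mstar) H hαW0 hαW1 hδFW
  obtain ⟨ML, hrow⟩ := rowConst261_spec_of_rowSum261 (rowSum261_geo9Y (d := d) (ℓ := ℓ) (hd := hd) (hL := hL) (b₀ := b₀) (b₁ := b₁) (Mstar := Mstar)) hσW
  have hc0 : (0 : ℝ) ≤ rowConst261 (@geo9Y d ℓ hd hL b₀ b₁ Mstar) σW := rowConst261_nonneg _ _
  have hαδ : 0 ≤ αW * δFW := (mul_pos hαW0 hδFW).le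
  refine ⟨max M₀ (max Mg ML), fun x hM α₀ hα ha U hU hU' h152x => ?_⟩
  letI : Fintype (geo9K x.toKIdx).Site := (inferInstance : Fintype (geo9Y x).Site)
  have hM0 : M₀ ≤ (geo9Y x).M := (le_max_left _ _).trans hM
  have hrowx : RowSum (toB6 (geo9Y x) 1 (H x)) σW (rowConst261 (@geo9Y d ℓ hd hL b₀ b₁ Mstar) σW) := fun y => hrow x (((le_max_right _ _).trans (le_max_right _ _)).trans hM) y
  have hFax := hFa x (((le_max_left _ _).trans (le_max_right _ _)).trans hM)
  have hG : GeoOK (geo9Y x) := ⟨geo9Y_dist_triangle x, geo9Y_dist_comm x, geo9K_dist_nonneg x.toKIdx, geo9Y_len_pos x⟩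
  have hN : 0 < N := Nat.pos_of_ne_zero (NeZero.ne N)
  have hϱ : 0 ≤ (cR39 (trBasis N))⁻¹ := inv_nonneg.2 (cR39_trBasis_pos hN).le
  have hR : (𝔬12 x).R U = (cR39 (trBasis N))⁻¹ • (LinearMap.id -
      PcoK x.toKIdx (trBasis N) (bg9YR (Matrix (Fin N) (Fin N) ℂ) (specialUnitaryUnits (Fin N)) R₁ R₂ x) (fun U => U) (parS x) (GpY x.toKIdx (parS x)) U) := by
    rw [hRco12 x U, rcoK_GpPhysY, rcoK_eq]
  have h49' : Proj349Maj (𝔬12 x).blkW (𝔬12 x).blk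
      (PcoK x.toKIdx (trBasis N) (bg9YR (Matrix (Fin N) (Fin N) ℂ) (specialUnitaryUnits (Fin N)) R₁ R₂ x) (fun U => U) (parS x) (GpY x.toKIdx (parS x)) U)
      ((𝔬12 x).Dv U) ((𝔬12 x).Dvstar U) 1 (H x) CP δP := by
    rw [hblkW12 x, hblk12 x, hDvco12 x U, hDvsco12 x U, ← hGp x]
    exact h49 x hM0 α₀ hα ha U hU
  have h31' : Thm31GpMaj (𝔬12 x).blkW (𝔬12 x).blk (GcoS x.toKIdx (trBasis N) (bg9YR (Matrix (Fin N) (Fin N) ℂ) (specialUnitaryUnits (Fin N)) R₁ R₂ x) (fun U => U) (GpY x.toKIdx (parS x)) U) ((𝔬12 x).Dv U) ((𝔬12 x).Dvstar U) 1 (H x) B₀ δ₀ := by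
    rw [hblkW12 x, hblk12 x, hDvco12 x U, hDvsco12 x U, ← hGp x]
    exact h31 x hM0 α₀ hα ha U hU
  -- `rgd2 = R∘G′∘D*` by the printed identity (3.152), Theorem 3.1 (`h31`) and (3.49) (`h49`): dag-n06-l g16 `rgd2_of_ids3152`, the member's `L ≤ ℓ+1` moved into `constA`
  have hLx : (geo9Y x).L ≤ (((ℓ + 1 : ℕ) : ℝ)) := (geo9Y_scalars x).2.1
  have hL0 : 0 ≤ (geo9Y x).L := le_trans zero_le_one hFax.one_le_L
  have hmono : constA (cR39 (trBasis N))⁻¹ B₀ CP (rowConst261 (@geo9Y d ℓ hd hL b₀ b₁ Mstar) σW) (geo9Y x).L ≤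
      constA (cR39 (trBasis N))⁻¹ B₀ CP (rowConst261 (@geo9Y d ℓ hd hL b₀ b₁ Mstar) σW) (((ℓ + 1 : ℕ) : ℝ)) := by
    unfold constA
    have h2 : (geo9Y x).L ^ 2 ≤ (((ℓ + 1 : ℕ) : ℝ)) ^ 2 := pow_le_pow_left₀ hL0 hLx 2
    have h3 : (geo9Y x).L ^ 2 * CP * rowConst261 (@geo9Y d ℓ hd hL b₀ b₁ Mstar) σW ≤ (((ℓ + 1 : ℕ) : ℝ)) ^ 2 * CP * rowConst261 (@geo9Y d ℓ hd hL b₀ b₁ Mstar) σW :=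
      mul_le_mul_of_nonneg_right (mul_le_mul_of_nonneg_right h2 hCP) hc0
    exact mul_le_mul_of_nonneg_left (by linarith) (mul_nonneg hϱ hB₀)
  exact rgd2_of_ids3152 hG hFax hrowx h31' h49' hR h152x hϱ hB₀ hCP hc0 hσW.le hαδ hδ₀ hδP (by linarith [hσW.le]) (hmono.trans hB₃r) (by linarith [hσW.le])

end Summit.QuantumFields.YangMills.BalabanUVNodes.N06Rgd2LegAtPinsPhysPUPar

end
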